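import Summits.BirchSwinnertonDyer.Rank1Residual.Additive.GordCycLeadingTermTwist
import Summits.BirchSwinnertonDyer.Rank1Residual.AdditivePotMult.AdditiveChiBranchPrime
import HarnessLib

/-!
# EVERY additive `(E, p)` with a SEMISTABLE ORDINARY twist by `p*`, `p ≥ 5`: the cyclotomic leading
# term `CycLeadingTermAt` is a theorem, and the rank-`0` upper half follows — ONE statement for the
# cells (M) and (G-ord) ∩ `I₀*` together (cell `b2b-bsdres`, sub-cell additive-p2, gen 13)

HONEST FRAMING (cell `b2b-bsdres`, run/shared/lean/b2b/bsd-rank1-residual/, verbatim in every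
file): the goal of the cell is to DELETE the COMBINATION-SHAPED residual classes of the
Birch–Swinnerton-Dyer formula for ALL analytic-rank `≤ 1` elliptic curves over `ℚ` — "full BSD
formula for every rank `≤ 1` curve in class `C`" assembled STRICTLY from published theorems — so
that the rank-`≤ 1` remainder becomes exactly the CONSTRUCTION-SHAPED classes, which are TYPED
(missing-input `Prop`s), NOT attempted. This is not "finishing BSD". Sub-cell `additive-p2`, gen 13:
research route; no claim beyond the stated classes; X3/X4 and their sub-classes stay
CONSTRUCTION-SHAPED; labels / census / located gap UNCHANGED; nothing is booked. Theorems only.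

WHAT. `GordCycLeadingTerm.lean` (p237375) types the rank-`0` Iwasawa input `CycLeadingTermAt W p`
("some `g ∈ char_Λ X(E/ℚ_∞)` has `g(0) = u · L(E,1)/Ω_E`") and proves its consumer;
`GordCycLeadingTermTwist.lean` (p237770) discharges it on the (G-ord) ∩ `I₀*` classes. Additive-p1's
`AdditivePotMult/AdditiveChiBranchPrime.lean` (p237439) proves the four `χ_p`-branch leading-term
predicates for EVERY additive `(W, p)` from the two SEMISTABLE component readings
`Wuthrich2014.kato_halfEigenCharIdeal_dvd_cyclotomicPrime_of_surjective` /
`Wuthrich2014.thm16_halfEigenCharIdeal_dvd_cyclotomicPrime` (Kato 2004 Thm. 17.4 (3) / Wuthrich 2014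
Thm. 16 on the `ω^{(p−1)/2}`-component, good-ordinary OR multiplicative twist). Here the two are
combined into ONE statement per image type, with the twist datum explicit:

* `Addv.cycLeadingTermAt_of_semistableTwist_of_surj` — `W` additive at `p ≥ 5`, `W = C • V^{(p*)}`
  with `V` globally minimal, GOOD ORDINARY OR MULTIPLICATIVE at `p`, `ρ̄_{W,p}` onto, `f` the newform
  of `V` with its two period ratios ⟹ `CycLeadingTermAt W p` (from the Kato-side half fact);
* `Addv.cycLeadingTermAt_of_semistableTwist_of_red` — the same with `E[p]` REDUCIBLE (Wuthrich side);
* `Addv.missingUpperBoundAt_rankZero_of_semistableTwist_of_surj` / `…_of_red` — hence, at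
  `r_an = 0`, the UPPER half `ord_p #Ш(E) ≤ ord_p #Ш_an(E)` for every such pair (Delbourgo 1998
  Prop. 4 `hDel`, GZK, modularity; the (G)-ordinary-or-(M) hypothesis of Prop. 4 is READ OFF the
  twist: `typeGOrd_or_padicValRat_j_neg_of_twist[_neg]`), the newform and periods supplied by
  `hmodD`.
These cover, in one theorem each, the rank-`0` rows of X4(M) ∪ X4♯(G-ord) ∩ `I₀*` (surj) and of
X3♯(M) ∪ X3♯(G-ord) ∩ `I₀*` (red) at `p ≥ 5` — the additive pairs whose twist by `p*` is semistable
ordinary; the complement inside X3/X4 is {defect `3,4,6`} ∪ {potentially supersingular}, where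
`CycLeadingTermAt` is NOT in print (module docstring of `GordCycLeadingTerm.lean`). Nothing new is
claimed beyond additive-p1's and additive-p2's gen-9/12/13 theorems; this is their common form.

References: Kato 2004 Thm. 17.4 (3) [Kato2004Asterisque]; Wuthrich 2014 Thm. 16 [Wuthrich2014];
Delbourgo 1998 Prop. 4 [Delbourgo1998]; Pal 2012 Thm. 3.2 [Pal2012].
-/

noncomputable section

open scoped Classical MatrixGroups ModularForm NumberField

open CongruenceSubgroup WeierstrassCurve NumberField Literature.NumberTheory.EllipticCurves
  Literature.NumberTheory.EllipticCurves.ModularForms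
  Literature.NumberTheory.EllipticCurves.Rank1Residual
  Literature.NumberTheory.EllipticCurves.Rank1Residual.Typed
  Summit.BirchSwinnertonDyer.Rank1Residual.AdditivePotMult
  IsDedekindDomain Rat.HeightOneSpectrum

namespace Summit.BirchSwinnertonDyer.Rank1Residual.Additive

variable (W : WeierstrassCurve ℚ) [W.IsElliptic] [W.IsGloballyMinimal] (p : ℕ) [hp : Fact p.Prime]

omit [W.IsElliptic] [W.IsGloballyMinimal] in
/-- A prime `p ≥ 5` is `≡ 1` or `≡ 3 (mod 4)`. -/
private theorem mod_four_of_five_le (hp5 : 5 ≤ p) : p % 4 = 1 ∨ p % 4 = 3 := by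
  obtain ⟨k, hk⟩ := hp.out.odd_of_ne_two (by omega)
  omega

/-! ### §1 `CycLeadingTermAt` on every additive pair with a semistable ordinary twist, `p ≥ 5` -/

/-- **Every additive `(E, p)`, `p ≥ 5`, with a SEMISTABLE ORDINARY twist and `ρ̄_{E,p}` onto:
`CycLeadingTermAt W p`.** Data: `W = C • V^{(p*)}`, `V` globally minimal, good ordinary or
multiplicative at `p`, its newform `f` and period ratios `ϖ · Ω_V = Ω⁺_f`, `ϖ' · |Ω⁻(V)| = Ω⁻_f`.
Inputs: the semistable big-image component reading (`hK`, Kato side; via additive-p1's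
`Addv.chiBranchLeadingTerm[Odd]BigImageAt_of_halfFact`), Pal 2012 Thm. 3.2 (`hPal`), modularity,
Serre's lifting (`p ≥ 5`), and §3 of `GordCycLeadingTermTwist`. Covers X4(M) and X4♯(G-ord) ∩ `I₀*`
at once. [cite: Kato2004Asterisque, Thm. 17.4 (3) (p. 273)] [cite: Pal2012, Thm. 3.2] -/
theorem Addv.cycLeadingTermAt_of_semistableTwist_of_surj
    (hK : Wuthrich2014.kato_halfEigenCharIdeal_dvd_cyclotomicPrime_of_surjective)
    (hPal : Pal2012.thm32_sqrt_mul_realPeriodRat_twist_eq_of_prime_one_mod_four)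
    (hmod : hasEntireLFunction_rat) (hp5 : 5 ≤ p) (hadd : Addv W p)
    (V : WeierstrassCurve ℚ) [V.IsElliptic] [V.IsGloballyMinimal] (C : VariableChange ℚ)
    (hC : C • V.quadraticTwist ((-1 : ℚ) ^ (p / 2) * p) = W) (hV : GoodOrd V p ∨ Mult V p)
    (hsurj : Surj W p) {N : ℕ} [NeZero N] {f : CuspForm (Gamma0 N) 2} (hf : IsNewformOf V f)
    (ϖ : ℚ) (hϖ : (ϖ : ℝ) * V.realPeriodRat = plusPeriod f)
    (ϖ' : ℚ) (hϖ' : (ϖ' : ℝ) * V.imaginaryPeriodRat = minusPeriod f) :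
    CycLeadingTermAt W p := by
  have hBCeven := Addv.chiBranchLeadingTermBigImageAt_of_halfFact (W := W) (p := p) hK hadd
  have hBCodd := Addv.chiBranchLeadingTermOddBigImageAt_of_halfFact (W := W) (p := p) hK hadd
  have hV' : Good V p ∨ Mult V p := hV.elim (fun h ↦ Or.inl h.1) Or.inr
  have hsurjV : ∀ n : ℕ, V.HasSurjectiveModNGaloisRep (p ^ n : ℕ) :=
    X4RankZeroTwistOdd.forall_surj_pow_twist_of_surj W p hp5 V (pStar_ne_zero p) C hC hsurj
  rcases mod_four_of_five_le p hp5 with h1 | h3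
  · have hC' : C • V.quadraticTwist (p : ℚ) = W := by
      rw [pStar_eq_of_mod_four p (Or.inl h1), if_pos h1] at hC
      exact hC
    exact cycLeadingTermAt_of_plusLeadingTerm W p hPal hmod h1 hadd V ⟨C, hC'⟩ hV' hf ϖ hϖ
      fun _ _ hκ hγ hγ' D ↦ (hBCeven V h1 ⟨C, hC'⟩ hV hsurjV hκ hγ hγ' hf D ϖ hϖ).2
  · have hC' : C • V.quadraticTwist (-(p : ℚ)) = W := by
      rw [pStar_eq_of_mod_four p (Or.inr h3), if_neg (by omega)] at hC
      exact hC
    have hC'' : C • V.quadraticTwist (((-(p : ℤ)) : ℤ) : ℚ) = W := by push_cast; exact hC'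
    have huC : padicValRat p (C.u : ℚ) = 0 :=
      padicValRat_u_eq_zero_of_twist_pm_p p (by omega) V W hV' (Or.inr rfl) C hC''
    exact cycLeadingTermAt_of_minusLeadingTerm W p hmod h3 hadd V C hC' huC hf ϖ' hϖ'
      fun _ _ hκ hγ hγ' D ↦ (hBCodd V h3 ⟨C, hC'⟩ hV hsurjV hκ hγ hγ' hf D ϖ' hϖ').2

/-- **Every additive `(E, p)`, `p ≥ 5`, with a SEMISTABLE ORDINARY twist and `E[p]` REDUCIBLE:
`CycLeadingTermAt W p`** — the Wuthrich side (`hWu`, via additive-p1's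
`Addv.chiBranchLeadingTerm[Odd]At_of_halfFact`). Covers X3♯(M) and X3♯(G-ord) ∩ `I₀*` at once.
[cite: Wuthrich2014, Thm. 16 (p. 397)] [cite: Pal2012, Thm. 3.2] -/
theorem Addv.cycLeadingTermAt_of_semistableTwist_of_red
    (hWu : Wuthrich2014.thm16_halfEigenCharIdeal_dvd_cyclotomicPrime)
    (hPal : Pal2012.thm32_sqrt_mul_realPeriodRat_twist_eq_of_prime_one_mod_four)
    (hmod : hasEntireLFunction_rat) (hp5 : 5 ≤ p) (hadd : Addv W p)
    (V : WeierstrassCurve ℚ) [V.IsElliptic] [V.IsGloballyMinimal] (C : VariableChange ℚ)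
    (hC : C • V.quadraticTwist ((-1 : ℚ) ^ (p / 2) * p) = W) (hV : GoodOrd V p ∨ Mult V p)
    (hred : Red W p) {N : ℕ} [NeZero N] {f : CuspForm (Gamma0 N) 2} (hf : IsNewformOf V f)
    (ϖ : ℚ) (hϖ : (ϖ : ℝ) * V.realPeriodRat = plusPeriod f)
    (ϖ' : ℚ) (hϖ' : (ϖ' : ℝ) * V.imaginaryPeriodRat = minusPeriod f) :
    CycLeadingTermAt W p := by
  have hBCeven := Addv.chiBranchLeadingTermAt_of_halfFact (W := W) (p := p) hWu hadd
  have hBCodd := Addv.chiBranchLeadingTermOddAt_of_halfFact (W := W) (p := p) hWu hadd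
  have hV' : Good V p ∨ Mult V p := hV.elim (fun h ↦ Or.inl h.1) Or.inr
  rcases mod_four_of_five_le p hp5 with h1 | h3
  · have hC' : C • V.quadraticTwist (p : ℚ) = W := by
      rw [pStar_eq_of_mod_four p (Or.inl h1), if_pos h1] at hC
      exact hC
    exact cycLeadingTermAt_of_plusLeadingTerm W p hPal hmod h1 hadd V ⟨C, hC'⟩ hV' hf ϖ hϖ
      fun _ _ hκ hγ hγ' D ↦ (hBCeven V h1 ⟨C, hC'⟩ hV hred hκ hγ hγ' hf D ϖ hϖ).2
  · have hC' : C • V.quadraticTwist (-(p : ℚ)) = W := by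
      rw [pStar_eq_of_mod_four p (Or.inr h3), if_neg (by omega)] at hC
      exact hC
    have hC'' : C • V.quadraticTwist (((-(p : ℤ)) : ℤ) : ℚ) = W := by push_cast; exact hC'
    have huC : padicValRat p (C.u : ℚ) = 0 :=
      padicValRat_u_eq_zero_of_twist_pm_p p (by omega) V W hV' (Or.inr rfl) C hC''
    exact cycLeadingTermAt_of_minusLeadingTerm W p hmod h3 hadd V C hC' huC hf ϖ' hϖ'
      fun _ _ hκ hγ hγ' D ↦ (hBCodd V h3 ⟨C, hC'⟩ hV hred hκ hγ hγ' hf D ϖ' hϖ').2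

/-! ### §2 Hence the rank-`0` upper half on every such pair -/

/-- The (G)-ordinary-or-(M) hypothesis of Delbourgo's Prop. 4, read off a semistable ordinary
twist by `p*` (both parities glued). -/
theorem typeGOrd_or_padicValRat_j_neg_of_pStar_twist (hp5 : 5 ≤ p)
    (V : WeierstrassCurve ℚ) [V.IsElliptic] [V.IsGloballyMinimal] (C : VariableChange ℚ)
    (hC : C • V.quadraticTwist ((-1 : ℚ) ^ (p / 2) * p) = W) (hV : GoodOrd V p ∨ Mult V p) :
    TypeGOrd W p ∨ padicValRat p W.j < 0 := by
  rcases mod_four_of_five_le p hp5 with h1 | h3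
  · have hC' : C • V.quadraticTwist (p : ℚ) = W := by
      rw [pStar_eq_of_mod_four p (Or.inl h1), if_pos h1] at hC
      exact hC
    exact typeGOrd_or_padicValRat_j_neg_of_twist W p h1 V ⟨C, hC'⟩ hV
  · have hC' : C • V.quadraticTwist (-(p : ℚ)) = W := by
      rw [pStar_eq_of_mod_four p (Or.inr h3), if_neg (by omega)] at hC
      exact hC
    exact typeGOrd_or_padicValRat_j_neg_of_twist_neg W p h3 V ⟨C, hC'⟩ hV

variable {W p}

/-- **Every additive `(E, p)`, `p ≥ 5`, with a semistable ordinary twist, `ρ̄_{E,p}` onto and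
`r_an(E) = 0`: the UPPER half `ord_p #Ш(E) ≤ ord_p #Ш_an(E)`** from the semistable big-image
component reading + Delbourgo 1998 Prop. 4 + GZK + modularity — X4(M) and X4♯(G-ord) ∩ `I₀*` in
one statement (newform and period ratios from `hmodD`). [cite: Kato2004Asterisque, Thm. 17.4 (3) (p. 273)]
[cite: Delbourgo1998, Prop. 4 (p. 144)] -/
theorem Addv.missingUpperBoundAt_rankZero_of_semistableTwist_of_surj
    (hK : Wuthrich2014.kato_halfEigenCharIdeal_dvd_cyclotomicPrime_of_surjective)
    (hDel : Delbourgo1998.prop4_rankZero_pow_dvd_constantCoeff)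
    (hPal : Pal2012.thm32_sqrt_mul_realPeriodRat_twist_eq_of_prime_one_mod_four)
    (hGZK : rank_eq_analyticRank_of_analyticRank_le_one) (hmod : hasEntireLFunction_rat)
    (hmodD : nonempty_modularParametrizationData) (hp5 : 5 ≤ p) (hadd : Addv W p)
    (V : WeierstrassCurve ℚ) [V.IsElliptic] [V.IsGloballyMinimal] (C : VariableChange ℚ)
    (hC : C • V.quadraticTwist ((-1 : ℚ) ^ (p / 2) * p) = W) (hV : GoodOrd V p ∨ Mult V p)
    (hsurj : Surj W p) (hr : W.analyticRank = 0) : MissingUpperBoundAt W p := by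
  haveI : NeZero (V.conductorNorm ℤ) := ⟨(V.conductorNorm_pos_holds).ne'⟩
  obtain ⟨Dm⟩ := hmodD V
  obtain ⟨ϖ, -, hϖ, -⟩ := Dm.exists_rat_mul_realPeriodRat_eq_plusPeriod
  obtain ⟨ϖ', -, hϖ'⟩ := exists_rat_mul_imaginaryPeriodRat_eq_minusPeriod Dm
  exact missingUpperBoundAt_of_cycLeadingTerm_of_five_le W p hDel hGZK hmod hp5 hadd
    (typeGOrd_or_padicValRat_j_neg_of_pStar_twist W p hp5 V C hC hV) hr
    (Addv.cycLeadingTermAt_of_semistableTwist_of_surj W p hK hPal hmod hp5 hadd V C hC hV hsurj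
      Dm.isNewformOf ϖ hϖ ϖ' hϖ')

/-- **Every additive `(E, p)`, `p ≥ 5`, with a semistable ordinary twist, `E[p]` REDUCIBLE and
`r_an(E) = 0`: the UPPER half** — X3♯(M) and X3♯(G-ord) ∩ `I₀*` in one statement.
[cite: Wuthrich2014, Thm. 16 (p. 397)] [cite: Delbourgo1998, Prop. 4 (p. 144)] -/
theorem Addv.missingUpperBoundAt_rankZero_of_semistableTwist_of_red
    (hWu : Wuthrich2014.thm16_halfEigenCharIdeal_dvd_cyclotomicPrime)
    (hDel : Delbourgo1998.prop4_rankZero_pow_dvd_constantCoeff)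
    (hPal : Pal2012.thm32_sqrt_mul_realPeriodRat_twist_eq_of_prime_one_mod_four)
    (hGZK : rank_eq_analyticRank_of_analyticRank_le_one) (hmod : hasEntireLFunction_rat)
    (hmodD : nonempty_modularParametrizationData) (hp5 : 5 ≤ p) (hadd : Addv W p)
    (V : WeierstrassCurve ℚ) [V.IsElliptic] [V.IsGloballyMinimal] (C : VariableChange ℚ)
    (hC : C • V.quadraticTwist ((-1 : ℚ) ^ (p / 2) * p) = W) (hV : GoodOrd V p ∨ Mult V p)
    (hred : Red W p) (hr : W.analyticRank = 0) : MissingUpperBoundAt W p := by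
  haveI : NeZero (V.conductorNorm ℤ) := ⟨(V.conductorNorm_pos_holds).ne'⟩
  obtain ⟨Dm⟩ := hmodD V
  obtain ⟨ϖ, -, hϖ, -⟩ := Dm.exists_rat_mul_realPeriodRat_eq_plusPeriod
  obtain ⟨ϖ', -, hϖ'⟩ := exists_rat_mul_imaginaryPeriodRat_eq_minusPeriod Dm
  exact missingUpperBoundAt_of_cycLeadingTerm_of_five_le W p hDel hGZK hmod hp5 hadd
    (typeGOrd_or_padicValRat_j_neg_of_pStar_twist W p hp5 V C hC hV) hr
    (Addv.cycLeadingTermAt_of_semistableTwist_of_red W p hWu hPal hmod hp5 hadd V C hC hV hred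
      Dm.isNewformOf ϖ hϖ ϖ' hϖ')

end Summit.BirchSwinnertonDyer.Rank1Residual.Additive

end
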